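import Summits.CriticalPhenomena.PercolationContinuityZ3.Theorems.PercNearOneGluingNearOneGluingSingleFinger
import Summits.CriticalPhenomena.PercolationContinuityZ3.Theorems.PercNearOneGluingNearOneGluingTerminalSeparation
import Summits.CriticalPhenomena.PercolationContinuityZ3.Theorems.PercNearOneGluingNearOneGluingWeightContinuity
import Literature.Probability.Percolation.ConditionalPositiveAssociationProofs
import HarnessLib

/-!
# `NoHeavyLowerTail` (stmt-CriticalPhenomena-4575), line one-cut — the LONELY RELAY LEMMA for every `|A|`
# and the one-cut bound whenever `E N ≤ 4` (in particular `|A| ≤ 4`), unconditionally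

For bond percolation with arbitrary edge probabilities on `Fin n` (`μ = prodBernoulli w`), an observer
`o` and a relay set `A`, let `N = |{a ∈ A : o ↔ a}|`.

* `lonelyRelay` — **`P(N = 1) ≤ max_{a ∈ A} P(a ↮ A ∖ a)`**: if every relay `a` is isolated from all
  the other relays with probability `≤ t`, then `P(N = 1) ≤ t` — NO factor `|A|`, NO hypothesis on `o`.
  This is Kozma–Nitzan's Lemma 2 (arXiv:2401.12397, p. 6: `Σ_k φ(X_k) ≤ φ(X)`) with singleton blocks and
  `X = A`: `Σ_a P(o ↔ a | a ↮ A∖a) ≤ P(o ↔ A) ≤ 1`, whence `P(N=1) = Σ_a P(o ↔ a, a ↮ A∖a) ≤ max_a P(a ↮ A∖a)`.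
  Mechanism (as in the tree's `stub_singleFinger`, crux stmt-4574, whose hub-free twin this is): terminal
  separation (`stub_terminalSeparation`, = BHK 2006 Thm 1.3 `BHK2006_clusterConditionalPositiveAssociation_holds`)
  gives `μ(o↔a, a↮A∖a)·μ(M) ≤ μ(a↮A∖a)·μ(o↔a, M)` with `M = {A pairwise separated}`; the events
  `{o↔a} ∩ M` are pairwise disjoint; sum over `a` and divide by `μ(M) > 0`; the case `μ(M) = 0` is removed
  by scaling the weights (`stub_weightContinuity`).
* `lonelyRelay_of_pairs` — the same with the pairwise hypothesis `P(a ↮ a') ≤ t` (`a ≠ a'`, `|A| ≥ 2`).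
* `oneCut_of_sum_le_four` — the ONE-CUT BOUND (hypothesis shape of `Theorems.noHeavyLowerTail_of_oneCut`)
  whenever `E N = Σ_a P(o ↔ a) ≤ 4`: then `{1 ≤ N < E N/2} ⊆ {N = 1}`.
* `oneCut_card_le_four` — in particular for every relay set with `A.card ≤ 4` (supersedes
  `oneCut_card_le_three` of `…OneCutThree.lean`, which went through the tripod exchange inequality).

So the rungs `|A| ≤ 4` of the one-cut engine are theorems; the first rung needing the distribution of
`N` beyond `{N = 1}` is `|A| = 5` with `E N > 4` (then `N ∈ {1, 2}` on the event).
-/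

namespace Summit.CriticalPhenomena.PercolationContinuityZ3.Theorems

open scoped BigOperators Classical Topology
open MeasureTheory Set Filter
open Literature.Probability.LatticeModels (prodBernoulli)
open Literature.Probability.Percolation (openConn openGraph BondConfig measurableSet_openConn_holds
  BHK2006_clusterConditionalPositiveAssociation_holds)

/-- **Cover.** If exactly one relay `a ∈ A` is joined to `o`, then `o ↔ a` and `a` is joined to no
other point of `A`. [folklore] -/
theorem lonelyRelay_subset_biUnion {n : ℕ} (A : Finset (Fin n)) (o : Fin n) :
    {ω : Set (Sym2 (Fin n)) | (A.filter fun a => ω ∈ openConn o a).card = 1} ⊆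
      ⋃ a ∈ A, (openConn o a ∩ {ω | ∀ t ∈ A.erase a, ω ∉ openConn a t}) := by
  intro ω hcard
  obtain ⟨a, ha⟩ := Finset.card_eq_one.1 hcard
  have haf : a ∈ A.filter fun a => ω ∈ openConn o a := by
    rw [ha]; exact Finset.mem_singleton_self a
  obtain ⟨haA, hoa⟩ := Finset.mem_filter.1 haf
  have hoa' : (openGraph ω).Reachable o a := hoa
  refine Set.mem_iUnion₂.2 ⟨a, haA, hoa, ?_⟩
  intro x hx hax
  have hax' : (openGraph ω).Reachable a x := hax
  obtain ⟨hxa, hxA⟩ := Finset.mem_erase.1 hx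
  have hxf : x ∈ A.filter fun a => ω ∈ openConn o a :=
    Finset.mem_filter.2 ⟨hxA, hoa'.trans hax'⟩
  rw [ha] at hxf
  exact hxa (Finset.mem_singleton.1 hxf)

/-- **The lonely relay bound when the separation event is non-null.**  Under terminal separation,
if every `a ∈ A` has `μ(a ↮ A∖a) ≤ t`, `0 ≤ t`, and `M = {A pairwise separated}` has `μ(M) > 0`, then
`μ{N = 1} ≤ t`. [cite: KozmaNitzan2024, Lemma 2 (p. 6) — singleton blocks] -/
theorem lonelyRelay_le_of_pairSep_pos
    (hTS : ∀ (n : ℕ) (w : Sym2 (Fin n) → unitInterval) (T : Finset (Fin n)) (o a : Fin n),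
      (prodBernoulli w).real (openConn o a ∩ {ω | ∀ t ∈ T, ω ∉ openConn a t}) *
        (prodBernoulli w).real ({ω | ∀ t ∈ T, ω ∉ openConn a t} ∩
            {ω | ∀ t ∈ T, ∀ t' ∈ T, t ≠ t' → ω ∉ openConn t t'}) ≤
      (prodBernoulli w).real {ω | ∀ t ∈ T, ω ∉ openConn a t} *
        (prodBernoulli w).real (openConn o a ∩ ({ω | ∀ t ∈ T, ω ∉ openConn a t} ∩
              {ω | ∀ t ∈ T, ∀ t' ∈ T, t ≠ t' → ω ∉ openConn t t'})))
    {n : ℕ} (w : Sym2 (Fin n) → unitInterval) (A : Finset (Fin n)) (o : Fin n) (t : ℝ)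
    (ht : 0 ≤ t)
    (hiso : ∀ a ∈ A, (prodBernoulli w).real {ω | ∀ t ∈ A.erase a, ω ∉ openConn a t} ≤ t)
    (hM : 0 < (prodBernoulli w).real
      {ω : Set (Sym2 (Fin n)) | ∀ x ∈ A, ∀ y ∈ A, x ≠ y → ω ∉ openConn x y}) :
    (prodBernoulli w).real
        {ω : Set (Sym2 (Fin n)) | (A.filter fun a => ω ∈ openConn o a).card = 1} ≤ t := by
  set μ := prodBernoulli w with hμ
  set M : Set (Set (Sym2 (Fin n))) := {ω | ∀ x ∈ A, ∀ y ∈ A, x ≠ y → ω ∉ openConn x y} with hMdef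
  -- (1) cover and union bound
  have h1 : μ.real {ω : Set (Sym2 (Fin n)) | (A.filter fun a => ω ∈ openConn o a).card = 1} ≤
      ∑ a ∈ A, μ.real (openConn o a ∩ {ω | ∀ t ∈ A.erase a, ω ∉ openConn a t}) :=
    (measureReal_mono (lonelyRelay_subset_biUnion A o) (measure_ne_top _ _)).trans
      (measureReal_biUnion_finset_le A _)
  -- (2) terminal separation, term by term
  have h2 : ∀ a ∈ A,
      μ.real (openConn o a ∩ {ω | ∀ t ∈ A.erase a, ω ∉ openConn a t}) * μ.real M ≤
        t * μ.real (openConn o a ∩ M) := by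
    intro a ha
    have key := hTS n w (A.erase a) o a
    rw [singleFinger_sep_inter_pairSep_eq A ha] at key
    exact key.trans (mul_le_mul_of_nonneg_right (hiso a ha) measureReal_nonneg)
  -- (3) disjointness of the events `{o ↔ a} ∩ M`
  have h3 : ∑ a ∈ A, μ.real (openConn o a ∩ M) ≤ μ.real M := by
    rw [← measureReal_biUnion_finset
      (singleFinger_pairwiseDisjoint_conn_inter_pairSep A A o subset_rfl)
      (fun a _ => MeasurableSet.of_discrete)]
    exact measureReal_mono (Set.iUnion₂_subset fun a _ => Set.inter_subset_right)
  -- (4) sum and divide by `μ(M) > 0`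
  have h4 : (∑ a ∈ A, μ.real (openConn o a ∩ {ω | ∀ t ∈ A.erase a, ω ∉ openConn a t})) *
      μ.real M ≤ t * μ.real M := by
    rw [Finset.sum_mul]
    calc ∑ a ∈ A, μ.real (openConn o a ∩ {ω | ∀ t ∈ A.erase a, ω ∉ openConn a t}) * μ.real M
        ≤ ∑ a ∈ A, t * μ.real (openConn o a ∩ M) := Finset.sum_le_sum h2
      _ = t * ∑ a ∈ A, μ.real (openConn o a ∩ M) := (Finset.mul_sum _ _ _).symm
      _ ≤ t * μ.real M := mul_le_mul_of_nonneg_left h3 ht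
  exact h1.trans (le_of_mul_le_mul_right h4 hM)

/-- **The lonely relay lemma, abstract form** (terminal separation and weight continuity as
hypotheses, both discharged below): `μ(a ↮ A∖a) ≤ t` for all `a ∈ A` implies `μ{N = 1} ≤ t`.
[cite: KozmaNitzan2024, Lemma 2 (p. 6) — singleton blocks] -/
theorem lonelyRelay_of_terminalSeparation
    (hTS : ∀ (n : ℕ) (w : Sym2 (Fin n) → unitInterval) (T : Finset (Fin n)) (o a : Fin n),
      (prodBernoulli w).real (openConn o a ∩ {ω | ∀ t ∈ T, ω ∉ openConn a t}) *
        (prodBernoulli w).real ({ω | ∀ t ∈ T, ω ∉ openConn a t} ∩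
            {ω | ∀ t ∈ T, ∀ t' ∈ T, t ≠ t' → ω ∉ openConn t t'}) ≤
      (prodBernoulli w).real {ω | ∀ t ∈ T, ω ∉ openConn a t} *
        (prodBernoulli w).real (openConn o a ∩ ({ω | ∀ t ∈ T, ω ∉ openConn a t} ∩
              {ω | ∀ t ∈ T, ∀ t' ∈ T, t ≠ t' → ω ∉ openConn t t'})))
    (hcont : ∀ (n : ℕ) (E : Set (BondConfig (Fin n))),
      Continuous fun w : Sym2 (Fin n) → unitInterval => (prodBernoulli w).real E)
    (n : ℕ) (w : Sym2 (Fin n) → unitInterval) (A : Finset (Fin n)) (o : Fin n) (t : ℝ)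
    (ht : 0 ≤ t)
    (hiso : ∀ a ∈ A, (prodBernoulli w).real {ω | ∀ t ∈ A.erase a, ω ∉ openConn a t} ≤ t) :
    (prodBernoulli w).real
        {ω : Set (Sym2 (Fin n)) | (A.filter fun a => ω ∈ openConn o a).card = 1} ≤ t := by
  -- the scaled weights `w_k = (1 - 1/(k+1)) • w`, all `< 1`, converging to `w`
  have hcmem : ∀ k : ℕ, ((1 : ℝ) - 1 / ((k : ℝ) + 1)) ∈ unitInterval := by
    intro k
    have hk : (0 : ℝ) < (k : ℝ) + 1 := Nat.cast_add_one_pos k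
    have h1 : 1 / ((k : ℝ) + 1) ≤ 1 := by
      rw [div_le_one hk]; linarith [(Nat.cast_nonneg k : (0 : ℝ) ≤ k)]
    have h0 : 0 ≤ 1 / ((k : ℝ) + 1) := by positivity
    exact ⟨by linarith, by linarith⟩
  set wk : ℕ → Sym2 (Fin n) → unitInterval :=
    fun k e => ⟨(1 - 1 / ((k : ℝ) + 1)) * (w e : ℝ), unitInterval.mul_mem (hcmem k) (w e).2⟩
    with hwk_def
  have hwk_lt : ∀ k e, ((wk k e : unitInterval) : ℝ) < 1 := by
    intro k e
    have hk : (0 : ℝ) < (k : ℝ) + 1 := Nat.cast_add_one_pos k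
    have hc : (1 : ℝ) - 1 / ((k : ℝ) + 1) < 1 := by
      have : 0 < 1 / ((k : ℝ) + 1) := by positivity
      linarith
    calc ((wk k e : unitInterval) : ℝ) = (1 - 1 / ((k : ℝ) + 1)) * (w e : ℝ) := rfl
      _ ≤ (1 - 1 / ((k : ℝ) + 1)) := mul_le_of_le_one_right (hcmem k).1 (w e).2.2
      _ < 1 := hc
  have hc_lim : Tendsto (fun k : ℕ => (1 : ℝ) - 1 / ((k : ℝ) + 1)) atTop (𝓝 1) := by
    simpa using tendsto_const_nhds.sub (tendsto_one_div_add_atTop_nhds_zero_nat (𝕜 := ℝ))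
  have hwk_lim : Tendsto wk atTop (𝓝 w) := by
    refine tendsto_pi_nhds.2 fun e => ?_
    rw [tendsto_subtype_rng]
    have h := hc_lim.mul_const (w e : ℝ)
    rw [one_mul] at h
    exact h
  have hlimE : ∀ E : Set (Set (Sym2 (Fin n))),
      Tendsto (fun k => (prodBernoulli (wk k)).real E) atTop (𝓝 ((prodBernoulli w).real E)) :=
    fun E => ((hcont n E).tendsto w).comp hwk_lim
  -- the error terms `δ k = ∑_{a ∈ A} |μ_{w_k}(a ↮ A∖a) - μ_w(a ↮ A∖a)| → 0`
  set δ : ℕ → ℝ := fun k => ∑ a ∈ A,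
      |(prodBernoulli (wk k)).real {ω | ∀ t ∈ A.erase a, ω ∉ openConn a t} -
        (prodBernoulli w).real {ω | ∀ t ∈ A.erase a, ω ∉ openConn a t}|
    with hδ_def
  have hδ0 : ∀ k, 0 ≤ δ k := fun k => Finset.sum_nonneg fun a _ => abs_nonneg _
  have hδ_lim : Tendsto δ atTop (𝓝 0) := by
    have h : ∀ a ∈ A, Tendsto (fun k =>
        |(prodBernoulli (wk k)).real {ω | ∀ t ∈ A.erase a, ω ∉ openConn a t} -
          (prodBernoulli w).real {ω | ∀ t ∈ A.erase a, ω ∉ openConn a t}|)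
        atTop (𝓝 0) := by
      intro a _
      simpa using (tendsto_sub_nhds_zero_iff.2
        (hlimE {ω | ∀ t ∈ A.erase a, ω ∉ openConn a t})).abs
    simpa [hδ_def] using tendsto_finsetSum A h
  -- the bound at each `k` (all weights `< 1`, so the separation event is non-null)
  have hk : ∀ k, (prodBernoulli (wk k)).real {ω : Set (Sym2 (Fin n)) |
      (A.filter fun a => ω ∈ openConn o a).card = 1} ≤ t + δ k := by
    intro k
    refine lonelyRelay_le_of_pairSep_pos hTS (wk k) A o (t + δ k) (by linarith [hδ0 k]) ?_
      (singleFinger_pairSep_real_pos (wk k) (hwk_lt k) _)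
    intro a ha
    have h1 := hiso a ha
    have h2 : |(prodBernoulli (wk k)).real {ω | ∀ t ∈ A.erase a, ω ∉ openConn a t} -
          (prodBernoulli w).real {ω | ∀ t ∈ A.erase a, ω ∉ openConn a t}| ≤ δ k :=
      Finset.single_le_sum (f := fun a =>
        |(prodBernoulli (wk k)).real {ω | ∀ t ∈ A.erase a, ω ∉ openConn a t} -
          (prodBernoulli w).real {ω | ∀ t ∈ A.erase a, ω ∉ openConn a t}|)
        (fun a _ => abs_nonneg _) ha
    have h3 := le_abs_self
      ((prodBernoulli (wk k)).real {ω | ∀ t ∈ A.erase a, ω ∉ openConn a t} -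
        (prodBernoulli w).real {ω | ∀ t ∈ A.erase a, ω ∉ openConn a t})
    linarith
  -- pass to the limit `k → ∞`
  have hlimt : Tendsto (fun k => t + δ k) atTop (𝓝 t) := by
    simpa using tendsto_const_nhds.add hδ_lim
  exact le_of_tendsto_of_tendsto' (hlimE _) hlimt hk

/-- **THE LONELY RELAY LEMMA** (all `|A|`, unconditional).  For bond percolation with arbitrary edge
probabilities on `Fin n`, any observer `o`, any relay set `A` and `t ≥ 0`: if every relay is isolated from
all the other relays with probability at most `t` (`μ(a ↮ A∖a) ≤ t`, `a ∈ A`), then the probability that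
EXACTLY ONE relay is joined to `o` is at most `t`:  `P(N = 1) ≤ max_{a∈A} P(a ↮ A∖a)`.  Equality for the
two-blob configurations (`o` glued to one relay, the others glued together).  Kozma–Nitzan's Lemma 2 with
singleton blocks, via BHK 2006 Thm 1.3 (both discharged in the tree).
[cite: KozmaNitzan2024, Lemma 2 (p. 6); VandenbergHaggstromKahn2005, Thm. 1.3] -/
theorem lonelyRelay (n : ℕ) (w : Sym2 (Fin n) → unitInterval) (A : Finset (Fin n)) (o : Fin n)
    (t : ℝ) (ht : 0 ≤ t)
    (hiso : ∀ a ∈ A, (prodBernoulli w).real {ω | ∀ t ∈ A.erase a, ω ∉ openConn a t} ≤ t) :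
    (prodBernoulli w).real
        {ω : Set (Sym2 (Fin n)) | (A.filter fun a => ω ∈ openConn o a).card = 1} ≤ t := by
  refine lonelyRelay_of_terminalSeparation (stub_terminalSeparation ?_) stub_weightContinuity
    n w A o t ht hiso
  intro n w s X F G hF hG hs
  exact BHK2006_clusterConditionalPositiveAssociation_holds (Fin n) w s X F G hF hG hs

/-- **Lonely relay lemma, pairwise form**: if `|A| ≥ 2` and `P(a ↮ a') ≤ t` for all distinct relays,
then `P(N = 1) ≤ t` (`{a ↮ A∖a} ⊆ {a ↮ a'}` for any `a' ≠ a`).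
[cite: KozmaNitzan2024, Lemma 2 (p. 6) — corollary] -/
theorem lonelyRelay_of_pairs (n : ℕ) (w : Sym2 (Fin n) → unitInterval) (A : Finset (Fin n))
    (o : Fin n) (t : ℝ) (hA : 2 ≤ A.card) (ht : 0 ≤ t)
    (hpair : ∀ a ∈ A, ∀ a' ∈ A, a ≠ a' → (prodBernoulli w).real (openConn a a')ᶜ ≤ t) :
    (prodBernoulli w).real
        {ω : Set (Sym2 (Fin n)) | (A.filter fun a => ω ∈ openConn o a).card = 1} ≤ t := by
  refine lonelyRelay n w A o t ht fun a ha => ?_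
  -- pick `a' ≠ a` in `A`
  have hcard : 1 ≤ (A.erase a).card := by
    rw [Finset.card_erase_of_mem ha]; omega
  obtain ⟨a', ha'⟩ := Finset.card_pos.1 hcard
  obtain ⟨hne, ha'A⟩ := Finset.mem_erase.1 ha'
  calc (prodBernoulli w).real {ω | ∀ t ∈ A.erase a, ω ∉ openConn a t}
      ≤ (prodBernoulli w).real (openConn a a')ᶜ := measureReal_mono fun ω hω => hω a' ha'
    _ ≤ t := hpair a ha a' ha'A (Ne.symm hne)

/-- **The one-cut bound whenever `E N ≤ 4`** (any `|A|`), unconditional: if `Σ_{a∈A} P(o ↔ a) ≤ 4`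
then `{1 ≤ N < E N / 2} ⊆ {N = 1}` and the lonely relay lemma applies (for `|A| ≤ 1` the event is
empty).  Binder shape of the hypothesis of `Theorems.noHeavyLowerTail_of_oneCut`, plus the mean bound.
[cite: KozmaNitzan2024, Lemma 2 (p. 6) — corollary] -/
theorem oneCut_of_sum_le_four :
    ∀ (n : ℕ) (w : Sym2 (Fin n) → unitInterval) (A : Finset (Fin n)) (o : Fin n) (t : ℝ),
      (∑ a ∈ A, (Literature.Probability.LatticeModels.prodBernoulli w).real
          (Literature.Probability.Percolation.openConn o a)) ≤ 4 → 0 ≤ t →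
      (∀ a ∈ A, ∀ a' ∈ A, a ≠ a' →
        (Literature.Probability.LatticeModels.prodBernoulli w).real
          (Literature.Probability.Percolation.openConn a a')ᶜ ≤ t) →
      (Literature.Probability.LatticeModels.prodBernoulli w).real
        {ω : Literature.Probability.Percolation.BondConfig (Fin n) |
          1 ≤ (A.filter fun a => ω ∈ Literature.Probability.Percolation.openConn o a).card ∧
          ((A.filter fun a => ω ∈ Literature.Probability.Percolation.openConn o a).card : ℝ) <
            (∑ a ∈ A, (Literature.Probability.LatticeModels.prodBernoulli w).real
              (Literature.Probability.Percolation.openConn o a)) / 2} ≤ t := by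
  intro n w A o t hEN ht hpair
  set μ := prodBernoulli w with hμ
  by_cases hA : 2 ≤ A.card
  · -- `E N ≤ 4`: the event lies in `{N = 1}`
    have hsub : {ω : BondConfig (Fin n) |
          1 ≤ (A.filter fun a => ω ∈ openConn o a).card ∧
          ((A.filter fun a => ω ∈ openConn o a).card : ℝ) <
            (∑ a ∈ A, μ.real (openConn o a)) / 2} ⊆
        {ω : Set (Sym2 (Fin n)) | (A.filter fun a => ω ∈ openConn o a).card = 1} := by
      rintro ω ⟨h1, h2⟩
      have h3 : ((A.filter fun a => ω ∈ openConn o a).card : ℝ) < 2 := by linarith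
      have h4 : (A.filter fun a => ω ∈ openConn o a).card < 2 := by exact_mod_cast h3
      change (A.filter fun a => ω ∈ openConn o a).card = 1
      omega
    exact (measureReal_mono hsub).trans (lonelyRelay_of_pairs n w A o t hA ht hpair)
  · -- `|A| ≤ 1`: `E N ≤ 1`, the event is empty
    have hA1 : A.card ≤ 1 := by omega
    have hEN1 : (∑ a ∈ A, μ.real (openConn o a)) ≤ 1 := by
      calc (∑ a ∈ A, μ.real (openConn o a)) ≤ ∑ _a ∈ A, (1 : ℝ) :=
            Finset.sum_le_sum fun a _ => measureReal_le_one
        _ = (A.card : ℝ) := by simp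
        _ ≤ 1 := by exact_mod_cast hA1
    have hempty : {ω : BondConfig (Fin n) |
          1 ≤ (A.filter fun a => ω ∈ openConn o a).card ∧
          ((A.filter fun a => ω ∈ openConn o a).card : ℝ) <
            (∑ a ∈ A, μ.real (openConn o a)) / 2} = ∅ := by
      ext ω
      simp only [mem_setOf_eq, mem_empty_iff_false, iff_false, not_and, not_lt]
      intro h1
      have : (1 : ℝ) ≤ (A.filter fun a => ω ∈ openConn o a).card := by exact_mod_cast h1
      linarith
    rw [hempty, measureReal_empty]
    exact ht

/-- **The one-cut bound for at most four relays** (the `|A| ≤ 4` rung of the engine of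
stmt-CriticalPhenomena-4575), unconditional: `E N ≤ |A| ≤ 4`, so `oneCut_of_sum_le_four` applies.
[cite: KozmaNitzan2024, Lemma 2 (p. 6) — corollary] -/
theorem oneCut_card_le_four :
    ∀ (n : ℕ) (w : Sym2 (Fin n) → unitInterval) (A : Finset (Fin n)) (o : Fin n) (t : ℝ),
      A.card ≤ 4 → 0 ≤ t →
      (∀ a ∈ A, ∀ a' ∈ A, a ≠ a' →
        (Literature.Probability.LatticeModels.prodBernoulli w).real
          (Literature.Probability.Percolation.openConn a a')ᶜ ≤ t) →
      (Literature.Probability.LatticeModels.prodBernoulli w).real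
        {ω : Literature.Probability.Percolation.BondConfig (Fin n) |
          1 ≤ (A.filter fun a => ω ∈ Literature.Probability.Percolation.openConn o a).card ∧
          ((A.filter fun a => ω ∈ Literature.Probability.Percolation.openConn o a).card : ℝ) <
            (∑ a ∈ A, (Literature.Probability.LatticeModels.prodBernoulli w).real
              (Literature.Probability.Percolation.openConn o a)) / 2} ≤ t := by
  intro n w A o t hA ht hpair
  refine oneCut_of_sum_le_four n w A o t ?_ ht hpair
  calc (∑ a ∈ A, (prodBernoulli w).real (openConn o a)) ≤ ∑ _a ∈ A, (1 : ℝ) :=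
        Finset.sum_le_sum fun a _ => measureReal_le_one
    _ = (A.card : ℝ) := by simp
    _ ≤ 4 := by exact_mod_cast hA

end Summit.CriticalPhenomena.PercolationContinuityZ3.Theorems
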